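import Summits.AtomisticToContinuum.Crystallization.Theses.FrustrationRangeCertificates
import Summits.AtomisticToContinuum.Crystallization.Theses.PalmUnimodularRigidity
import Summits.AtomisticToContinuum.Crystallization.Theorems.FrustrationRangeCertificatesPatternPricedCertificatesBridgeEndState
import Summits.AtomisticToContinuum.Crystallization.Theorems.PalmUnimodularRigidityCruxesToPalmRigidity
import Summits.AtomisticToContinuum.Crystallization.Theorems.PalmUnimodularRigidityShellsToBarlowChart
import Summits.AtomisticToContinuum.Crystallization.Theorems.PalmUnimodularRigidityLayeredLawsSelectHcpRelaxedReference
import Summits.AtomisticToContinuum.Crystallization.Theorems.PalmUnimodularRigidityLayeredLawsSelectHcpUniqueMinimiser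
import Summits.AtomisticToContinuum.Crystallization.Theorems.PRVarianceCertificateCoerciveVarianceCertificateMatching

/-!
# Crux `PatternPricedCertificates` (stmt-AtomisticToContinuum-12974) — the strategist's SPLIT

`PatternPricedCertificates ⇐ MinimiserShells ∧ LayeredLawsSelectHcp` (the two OPEN cruxes stmt-AtomisticToContinuum-9225 /
stmt-AtomisticToContinuum-9226 of route `PalmUnimodularRigidity`), by pure composition of theorems of the tree:

* the box-local unique-minimiser statement for the Lennard-Jones hcp family (stub B5' `stub_hcpUniqueMinimiser` of line
  `registered`, verbatim) is a THEOREM: `stub_hcpUniqueMinimiser` below (landed BY NAME), from the landed certified lattice-sum development of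
  crux `LayeredLawsSelectHcp` — `stub_relaxedReference` (a global minimiser of `hcpE` exists and lies in
  `[189/200, 199/200] × [77/100, 163/200]`), `tube_hcpE_unique_minimiser` (the global minimiser of `hcpE` on the open quadrant is
  unique) and `energyPerParticle_hcp_eq_hcpE` (`e_LJ(hcp_{a,h}) = hcpE a h`);
* hence the crux follows from `PalmRigidity` (stmt-AtomisticToContinuum-9224) ALONE:
  `patternPricedCertificates_of_palmRigidity_alone` (the end-state theorem
  `patternPricedCertificates_of_uniqueMinimiser_of_palmRigidity` of line `registered` fed with `stub_hcpUniqueMinimiser`);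
* and `PalmRigidity ⇐ MinimiserShells → ShellsToBarlowChart → LayeredLawsSelectHcp` is the CLOSED glue item
  `CruxesToPalmRigidity` (stmt-AtomisticToContinuum-9228, `cruxesToPalmRigidity_proof`) with `ShellsToBarlowChart`
  (stmt-AtomisticToContinuum-9227) CLOSED (`ShellsToBarlowChart_of`).

The split theorem `PatternPricedCertificates_of_subs : MinimiserShells → LayeredLawsSelectHcp → PatternPricedCertificates` is the
`--glue-by` declaration of `ledger route edit route-AtomisticToContinuum-FrustrationRangeCertificates --split PatternPricedCertificates`.
Landing `stub_hcpUniqueMinimiser` by name leaves the skeleton `Lines/birth.lean` closed modulo its single EXTERNAL stub `stub_palmRigidity` = stmt-AtomisticToContinuum-9224.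
`[folklore]` — no new definitions, no numerics, no `sorry`.
-/

noncomputable section

namespace Summit.AtomisticToContinuum.Crystallization.Theorems.PatternPricedCertificates

open Literature.MathematicalPhysics.StatisticalMechanics
open Summit.AtomisticToContinuum.Crystallization.Theorems.PalmUnimodularRigidity.LayeredLawsSelectHcp
  (hcpE stub_relaxedReference tube_hcpE_unique_minimiser)
open Summit.AtomisticToContinuum.Crystallization.Theorems.PRVarianceCertificate.CoerciveVarianceCertificate
  (energyPerParticle_hcp_eq_hcpE)

/-- **B5' is a theorem of the tree** — the registered stub `stub_hcpUniqueMinimiser` of line `registered` (crux stmt-AtomisticToContinuum-12974;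
verbatim header of `Cruxes/PatternPricedCertificates/Lines/birth.lean` v12), landed BY NAME: the Lennard-Jones
energy per particle of the hcp family `hcp_{a,h}` has a UNIQUE minimiser on the box `[1/2, 2]²` — in the strong form "every box point
whose energy does not exceed that of `(a₀, h₀)` is `(a₀, h₀)`". Proof: take the global minimiser `(a₀, h₀)` of `hcpE` on the open
quadrant (`stub_relaxedReference`, it lies in `[189/200, 199/200] × [77/100, 163/200] ⊂ [1/2, 2]²`); a box point with
`e ≤ e(a₀, h₀)` has `hcpE a h = hcpE a₀ h₀` (`energyPerParticle_hcp_eq_hcpE`), hence equals `(a₀, h₀)` by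
`tube_hcpE_unique_minimiser`. [folklore] -/
theorem stub_hcpUniqueMinimiser :
    ∃ (a₀ h₀ : ℝ) (ha₀ : a₀ ≠ 0) (hh₀ : h₀ ≠ 0), 1 / 2 ≤ a₀ ∧ a₀ ≤ 2 ∧ 1 / 2 ≤ h₀ ∧ h₀ ≤ 2 ∧
      ∀ (a h : ℝ) (ha : a ≠ 0) (hh : h ≠ 0), 1 / 2 ≤ a → a ≤ 2 → 1 / 2 ≤ h → h ≤ 2 →
        (Literature.MathematicalPhysics.StatisticalMechanics.hcpPeriodicConfiguration ha hh).energyPerParticle Literature.MathematicalPhysics.StatisticalMechanics.lennardJones ≤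
          (Literature.MathematicalPhysics.StatisticalMechanics.hcpPeriodicConfiguration ha₀ hh₀).energyPerParticle Literature.MathematicalPhysics.StatisticalMechanics.lennardJones →
        a = a₀ ∧ h = h₀ := by
  obtain ⟨a₀, h₀, ha₁, ha₂, hh₁, hh₂, hmin⟩ := stub_relaxedReference
  have ha₀ : (0 : ℝ) < a₀ := by linarith
  have hh₀ : (0 : ℝ) < h₀ := by linarith
  refine ⟨a₀, h₀, ha₀.ne', hh₀.ne', by linarith, by linarith, by linarith, by linarith, ?_⟩
  intro a h ha hh ha1 _ha2 hh1 _hh2 hle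
  have hapos : (0 : ℝ) < a := by linarith
  have hhpos : (0 : ℝ) < h := by linarith
  rw [energyPerParticle_hcp_eq_hcpE ha hh, energyPerParticle_hcp_eq_hcpE ha₀.ne' hh₀.ne'] at hle
  have heq : hcpE a h = hcpE a₀ h₀ := le_antisymm hle (hmin a h hapos hhpos)
  exact tube_hcpE_unique_minimiser a₀ h₀ a h ha₀ hh₀ hapos hhpos hmin heq

/-- **The crux from `PalmRigidity` alone**: `PalmRigidity (stmt-AtomisticToContinuum-9224) → PatternPricedCertificates`
(the end-state theorem of line `registered` with B5' discharged by `stub_hcpUniqueMinimiser`). [folklore] -/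
theorem patternPricedCertificates_of_palmRigidity_alone :
    _root_.Summit.AtomisticToContinuum.Crystallization.Theses.PalmUnimodularRigidity.PalmRigidity →
      _root_.Summit.AtomisticToContinuum.Crystallization.Theses.FrustrationRangeCertificates.PatternPricedCertificates :=
  patternPricedCertificates_of_uniqueMinimiser_of_palmRigidity stub_hcpUniqueMinimiser

/-- **The split glue** (`--glue-by` of the strategist's decomposition of the crux):
`MinimiserShells (stmt-AtomisticToContinuum-9225) → LayeredLawsSelectHcp (stmt-AtomisticToContinuum-9226) → PatternPricedCertificates`,
through the closed items `ShellsToBarlowChart` (stmt-9227, `ShellsToBarlowChart_of`) and `CruxesToPalmRigidity` (stmt-9228,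
`cruxesToPalmRigidity_proof`) and `patternPricedCertificates_of_palmRigidity_alone`. [folklore] -/
theorem PatternPricedCertificates_of_subs :
    _root_.Summit.AtomisticToContinuum.Crystallization.Theses.PalmUnimodularRigidity.MinimiserShells →
      _root_.Summit.AtomisticToContinuum.Crystallization.Theses.PalmUnimodularRigidity.LayeredLawsSelectHcp →
        _root_.Summit.AtomisticToContinuum.Crystallization.Theses.FrustrationRangeCertificates.PatternPricedCertificates :=
  fun hShells hSelect =>
    patternPricedCertificates_of_palmRigidity_alone
      (_root_.Summit.AtomisticToContinuum.Crystallization.Theorems.PalmUnimodularRigidity.cruxesToPalmRigidity_proof hShells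
        _root_.Summit.AtomisticToContinuum.Crystallization.Cruxes.ShellsToBarlowChart.DevelopTheModelGrowthDescent.ShellsToBarlowChart_of
        hSelect)

end Summit.AtomisticToContinuum.Crystallization.Theorems.PatternPricedCertificates

end
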